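import Mathlib
import HarnessLib
import Summits.HubbardSuperconductivity.HubbardSuperconductivity.Theorems.KLProgrammeKLRegimeEngineTwoLegStepV17FBareFrame
import Summits.HubbardSuperconductivity.HubbardSuperconductivity.Theorems.KLProgrammeKLRegimeFlowReadScaleZeroSplit
import Summits.HubbardSuperconductivity.HubbardSuperconductivity.Theorems.KLProgrammeKLRegimeTwoLegCurvatureConstsJetC2

/-!
# Route `KLProgramme`, crux K3 — gen-8 ENGINE-FLOW child (stmt-HubbardSuperconductivity-20437 `KLRegimeEngineV17F2`), stub (C)
# `stub_twoLeg_curvature` at `n = 0`: «(C)-SCALE0-DOORS» — BOTH conjuncts of (C) at the bare frame from NATURAL-SIZE pinned sums of the scale-`0`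
# two-leg kernel (on-site value `v·|U|`, off-site moments `b_k·U²`, `k ≤ 4`) — the doors located item #22 «(C)-SCALE0-NATURAL» plugs into

Seat hubbard-kl-k3c3-p1 (g11; row «δμ-flow with klAngularMean constant piece»; pen (R109): «split/doors supplier» of #22, owner k3c5-p1 lineage).
The n = 0 case of stub (C) asks `TwoLegReadJetBound L M klC4aJetC2 (klC4aJetC' P R) β U μ (K₀) 0 ∧ TwoLegReadOscAt L M (klReadOscC P R) β U μ (K₀) 0`
(`K₀ = klFlowFrameU … 0 = 0`).  The tree's generic chain at the bare frame — p1b's `twoLeg_momentumSizes_zero_frameZero_of_grid_upto` (grid → momentum sup-jets),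
`twoLeg_readJets_frameZero` / k3c3-p3's `abs_iteratedDeriv_comp_fermiPointLp_le_curveJetBar` (momentum sup-jets → angular jets on the free curve, tables
`readJetC/readJetC'`), and this seat's `twoLegReadOscAt_frameZero_of_offSite` (off-site value → mean-free clause, p600439) — is assembled here ONCE, keyed by
the two numbers the natural-size supplier («(C)-SCALE0-PT2») has to produce for `W₀ := effAction (S_{4M}ᵀ C⁰_{>e₀} S_{4M}) V_{4M}`:

  (on)  `Σ_{p₁} [x⃗₁ = x⃗₀]·‖kernel₂ W₀ ((p₀,σ,+),(p₁,σ,−))‖ ≤ v·|U|·β/(4M)`                 (the on-site VALUE: first order = Hartree, natural `v = O(1)`),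
  (off) `Σ_{p₁} [x⃗₁ ≠ x⃗₀]·(1+|Δx̃₀|+|Δx̃₁|)ᵏ·‖kernel₂ W₀ (…)‖ ≤ b k·U²·β/(4M)`, `k ≤ 4`   (the OFF-SITE moments: second order explicit + `U³` remainder),

* §1 `twoLeg_momentumSizes_frameZero_of_split` — `‖I_L[σ₀]‖ ≤ 2(v|U| + b₀U²)`, `‖DᵏI_L[σ₀]‖ ≤ 2·b_k·U²` (`1 ≤ k ≤ 4`);
* §2 **`twoLegRead_frameZero_of_offSite`** — `TwoLegReadJetBound L M cN cN′ β U μ (K₀) 0 ∧ TwoLegReadOscAt L M (4b₀) β U μ (K₀) 0` with the EXPLICIT private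
  tables `cN 0 = 2v`, `cN k = readJetC (2b) k`; `cN′ 0 = 2b₀`, `cN′ k = readJetC′ R (2b) k` — the closer's PRIVATE BASE (`cc(0), cc′(0), x₀(0) = 4b₀`);
* §3 **`twoLegRead_frameZero_registered_of_offSite`** — plus five numeric fits against `klC4aJetC2 / klC4aJetC′ P R / klReadOscC P R` ⟹ the REGISTERED n = 0
  conclusion of stub (C) verbatim; **`…_klEng`** — the same under (C)'s literal binders `c ≤ klEngC₃6 P R`, `U ≤ klEngU₀9 P R c`, `R.WF2`.

Proofs only; no definitions; nothing here asserts any stub of 20437, K3 or superconductivity — the natural-size inputs (on)/(off) are HYPOTHESES (item #22).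
References: BGM 2006 §2.4 (2.36), §3 (3.2)–(3.3) [cite: BenfattoGiulianiMastropietro2006].
-/

noncomputable section

namespace Summit.HubbardSuperconductivity.HubbardSuperconductivity.Theorems.KLRegimeSplit

set_option linter.dupNamespace false -- summit = problem name (single-conjunct summit), D-0017

open Real Finset Literature.MathematicalPhysics.QuantumLattice Literature.Probability.LatticeModels GrassmannAlgebra
open Literature.MathematicalPhysics.QuantumLattice.FermiRG Literature.Probability.LatticeModels.BattleFederbush
open Summit.HubbardSuperconductivity.HubbardSuperconductivity.Theorems.KLProgrammeLegKernels
open Summit.HubbardSuperconductivity.HubbardSuperconductivity.Theorems.TwoLegFourier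
open Summit.HubbardSuperconductivity.HubbardSuperconductivity.Theorems.EngineV8
open Summit.HubbardSuperconductivity.HubbardSuperconductivity.Theorems.PerturbedFermiCurve
open Summit.HubbardSuperconductivity.HubbardSuperconductivity.Theorems.DispersionFlow

variable {L M : ℕ} [NeZero L] [NeZero M] {R : RenConsts} {μ U β c : ℝ}

/-! ## §1 Momentum sup-jets of `I_L[σ₀]` from the split pinned sums -/

/-- **Momentum sizes of the interpolated scale-`0` symbol from the ON-SITE value sum and the OFF-SITE moments** (natural normalisation `·β/(4M)`):
`‖I_L[σ₀]‖ ≤ 2(v|U| + b₀U²)` and `‖DᵏI_L[σ₀]‖ ≤ 2·b_k·U²` for `1 ≤ k ≤ 4` (p1b's grid→momentum bridge; the full zeroth sum is on-site + off-site). -/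
theorem twoLeg_momentumSizes_frameZero_of_split (hβ : klBetaMin ≤ β) (U μ : ℝ) {v : ℝ} {b : ℕ → ℝ}
    (hBon : ∀ (σ : Fin 2) (p₀ : GridPoint L (2 * (2 * M))), ∑ p₁ : GridPoint L (2 * (2 * M)),
      (if p₁.2 - p₀.2 = 0 then (1 : ℝ) else 0) *
        ‖kernel ℂ
          (effAction ℂ ((hubbardGridSub L M β (2 * (2 * M))).transpose * hubbardCovAboveCT L M β μ 0 0 klE0 *
              hubbardGridSub L M β (2 * (2 * M))) (hubbardGridInteraction L (2 * (2 * M)) β U))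
          2 (fun i => ((![p₀, p₁] i, σ), i))‖ ≤ v * |U| * (β / ((2 * (2 * M) : ℕ) : ℝ)))
    (hBoff : ∀ k ≤ 4, ∀ (σ : Fin 2) (p₀ : GridPoint L (2 * (2 * M))), ∑ p₁ : GridPoint L (2 * (2 * M)),
      (if p₁.2 - p₀.2 = 0 then (0 : ℝ) else
        (1 + (((p₁.2 - p₀.2) 0).valMinAbs.natAbs : ℝ) + (((p₁.2 - p₀.2) 1).valMinAbs.natAbs : ℝ)) ^ k) *
        ‖kernel ℂ
          (effAction ℂ ((hubbardGridSub L M β (2 * (2 * M))).transpose * hubbardCovAboveCT L M β μ 0 0 klE0 *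
              hubbardGridSub L M β (2 * (2 * M))) (hubbardGridInteraction L (2 * (2 * M)) β U))
          2 (fun i => ((![p₀, p₁] i, σ), i))‖ ≤ b k * U ^ 2 * (β / ((2 * (2 * M) : ℕ) : ℝ))) :
    (∀ q : Momentum, ‖iteratedFDeriv ℝ 0 (evalM (symInterp L (klLocSelfEnergyRe L M β U μ 0 0))) q‖ ≤ 2 * (v * |U| + b 0 * U ^ 2)) ∧
      ∀ k, 1 ≤ k → k ≤ 4 → ∀ q : Momentum,
        ‖iteratedFDeriv ℝ k (evalM (symInterp L (klLocSelfEnergyRe L M β U μ 0 0))) q‖ ≤ 2 * b k * U ^ 2 := by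
  have hβ0 : 0 < β := lt_of_lt_of_le (by norm_num [klBetaMin]) hβ
  set B : ℕ → ℝ := fun k => if k = 0 then (v * |U| + b 0 * U ^ 2) * (β / ((2 * (2 * M) : ℕ) : ℝ))
    else b k * U ^ 2 * (β / ((2 * (2 * M) : ℕ) : ℝ)) with hB
  have h := twoLeg_momentumSizes_zero_frameZero_of_grid_upto (L := L) (M := M) hβ0.ne' U μ 4 (B := B)
    (fun σ p₀ => by
      -- the full zeroth sum = on-site + off-site (weight `(1+…)⁰ = 1` off the diagonal)
      have hon := hBon σ p₀
      have hoff := hBoff 0 (Nat.zero_le _) σ p₀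
      simp only [pow_zero] at hoff
      have hsum := add_le_add hon hoff
      rw [← sum_add_distrib] at hsum
      refine le_trans (le_of_eq (sum_congr rfl fun p₁ _ => ?_)) (hsum.trans (le_of_eq ?_))
      · by_cases hp : p₁.2 - p₀.2 = 0
        · rw [if_pos hp, if_pos hp]; ring
        · rw [if_neg hp, if_neg hp]; ring
      · simp only [hB, if_true]; ring)
    (fun k hk hk4 σ p₀ => by
      have hk0 : k ≠ 0 := by omega
      simpa only [hB, hk0, if_false] using hBoff k hk4 σ p₀)
  refine ⟨fun q => (h 0 (Nat.zero_le _) q).trans (le_of_eq ?_), fun k hk hk4 q => (h k hk4 q).trans (le_of_eq ?_)⟩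
  · simp only [hB, if_true]
    rw [gridNorm_mul_eq (L := L) (M := M) hβ0]
  · have hk0 : k ≠ 0 := by omega
    simp only [hB, hk0, if_false]
    rw [gridNorm_mul_eq (L := L) (M := M) hβ0]; ring

/-! ## §2 Both conjuncts of (C) at the bare frame, private tables -/

/-- **(C) AT `n = 0` FROM NATURAL-SIZE INPUTS — PRIVATE TABLES.**  In the regime (`c ≤ klCurveC3 R`, `U ≤ klCurveU0 R`, `U ≤ 1`, `klBetaMin ≤ β ≤ e^{c/U²}`,
`μ ∈ klWindowC`), the on-site value sum `≤ v·|U|·β/(4M)` and the off-site moments `≤ b_k·U²·β/(4M)` (`k ≤ 4`, `b ≥ 0`) of `W₀`'s two-leg kernel give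
`TwoLegReadJetBound L M cN cN′ β U μ (K₀) 0 ∧ TwoLegReadOscAt L M (4·b 0) β U μ (K₀) 0` with `cN = (2v, readJetC (2b) 1…4)`, `cN′ = (2b₀, readJetC′ R (2b) ·)`
— the closer's private base `(cc(0), cc′(0), x₀(0))`. -/
theorem twoLegRead_frameZero_of_offSite (hRW : R.WF) (hc : 0 < c) (hcle : c ≤ klCurveC3 R) (hμ : μ ∈ klWindowC) (hU : 0 < U)
    (hUle : U ≤ klCurveU0 R) (hU1 : U ≤ 1) (hβ : klBetaMin ≤ β) (hβc : β ≤ Real.exp (c / U ^ 2)) {v : ℝ} {b : ℕ → ℝ} (hb : ∀ k, 0 ≤ b k)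
    (hBon : ∀ (σ : Fin 2) (p₀ : GridPoint L (2 * (2 * M))), ∑ p₁ : GridPoint L (2 * (2 * M)),
      (if p₁.2 - p₀.2 = 0 then (1 : ℝ) else 0) *
        ‖kernel ℂ
          (effAction ℂ ((hubbardGridSub L M β (2 * (2 * M))).transpose * hubbardCovAboveCT L M β μ 0 0 klE0 *
              hubbardGridSub L M β (2 * (2 * M))) (hubbardGridInteraction L (2 * (2 * M)) β U))
          2 (fun i => ((![p₀, p₁] i, σ), i))‖ ≤ v * |U| * (β / ((2 * (2 * M) : ℕ) : ℝ)))
    (hBoff : ∀ k ≤ 4, ∀ (σ : Fin 2) (p₀ : GridPoint L (2 * (2 * M))), ∑ p₁ : GridPoint L (2 * (2 * M)),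
      (if p₁.2 - p₀.2 = 0 then (0 : ℝ) else
        (1 + (((p₁.2 - p₀.2) 0).valMinAbs.natAbs : ℝ) + (((p₁.2 - p₀.2) 1).valMinAbs.natAbs : ℝ)) ^ k) *
        ‖kernel ℂ
          (effAction ℂ ((hubbardGridSub L M β (2 * (2 * M))).transpose * hubbardCovAboveCT L M β μ 0 0 klE0 *
              hubbardGridSub L M β (2 * (2 * M))) (hubbardGridInteraction L (2 * (2 * M)) β U))
          2 (fun i => ((![p₀, p₁] i, σ), i))‖ ≤ b k * U ^ 2 * (β / ((2 * (2 * M) : ℕ) : ℝ))) :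
    TwoLegReadJetBound L M (fun k => if k = 0 then 2 * v else readJetC (fun l => 2 * b l) k)
        (fun k => if k = 0 then 2 * b 0 else readJetC' R (fun l => 2 * b l) k) β U μ (klFlowFrameU L M β U μ 0) 0 ∧
      TwoLegReadOscAt L M (4 * b 0) β U μ (klFlowFrameU L M β U μ 0) 0 := by
  have hR : ∀ j, 0 ≤ R.Gfr j := hRW.2.2
  have hβ0 : 0 < β := lt_of_lt_of_le (by norm_num [klBetaMin]) hβ
  obtain ⟨h0, hk⟩ := twoLeg_momentumSizes_frameZero_of_split (L := L) (M := M) hβ U μ hBon hBoff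
  have hK0 : FrameOK R U 0 μ 0 := klFrameOK_zeroC hRW U 0 hμ
  have hK0' : FrameOK R U (nScales β) μ 0 := klFrameOK_zeroC hRW U (nScales β) hμ
  set μc : ℕ → ℝ := fun l => 2 * b l with hμc
  have hμc0 : ∀ l, 0 ≤ μc l := fun l => by rw [hμc]; have := hb l; positivity
  -- `ν₀(0)` is `C⁴` with the structured angular jets (value from the zeroth size)
  obtain ⟨hC, hval⟩ := twoLeg_readJets_frameZero (L := L) (M := M) hR hc hcle hU hUle hβ hβc hμ hK0'
    (m := fun k => if k = 0 then 2 * (v * |U| + b 0 * U ^ 2) else 2 * b k * U ^ 2)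
    (fun k hk4 q => by
      rcases Nat.eq_zero_or_pos k with rfl | hkpos
      · simpa only [if_true] using h0 q
      · have hkne : k ≠ 0 := by omega
        simpa only [hkne, if_false] using hk k hkpos hk4 q)
  set F : Momentum → ℝ := evalM (symInterp L (klLocSelfEnergyRe L M β U μ 0 0)) with hF
  have hFc : ContDiff ℝ 4 F := contDiff_evalM _
  have hνF : klLocalPart L M β U μ 0 0 = F ∘ fun θ : ℝ => (WithLp.toLp 2 (klFermiPoint μ 0 θ) : Momentum) := by
    have h := klLocalPart_zero_sub_frame_eq_comp (L := L) (M := M) β U μ (0 : TrigPolyC4v)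
    have hl : (fun θ => klLocalPart L M β U μ 0 0 θ - (0 : TrigPolyC4v).eval (klFermiPoint μ 0 θ)) = klLocalPart L M β U μ 0 0 := by
      funext θ; simp
    rw [hl] at h
    rw [h]
    congr 1
    funext p
    simp [hF, evalM_apply]
  have hjets : TwoLegReadJetBound L M (fun k => if k = 0 then 2 * v else readJetC (fun l => 2 * b l) k)
      (fun k => if k = 0 then 2 * b 0 else readJetC' R (fun l => 2 * b l) k) β U μ (klFlowFrameU L M β U μ 0) 0 := by
    rw [klFlowFrameU_zero]
    refine ⟨hC, fun k hk4 θ => ?_⟩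
    rcases Nat.eq_zero_or_pos k with rfl | hkpos
    · -- order 0: the value `≤ 2v|U| + 2b₀U² = (2v + 2b₀|U|)·|U|`
      rw [iteratedDeriv_zero]
      refine ((hval θ).1).trans (le_of_eq ?_)
      simp only [if_true, curveJetBar, uPow, Nat.cast_zero, zero_sub, mul_zero, zpow_zero, mul_one]
      rw [abs_of_pos hU]; ring
    · -- orders 1–4: k3c3-p3's structured link at the bare frame (depth 0, scale 0)
      have hkne : k ≠ 0 := by omega
      have hcurve := abs_iteratedDeriv_comp_fermiPointLp_le_curveJetBar (n := 0) hR hc hcle hU hUle hU1 hβ hβc hμ hK0 le_rfl (Nat.zero_le _)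
        hFc hμc0 θ (fun l hl1 hl4 => by
          have h := hk l hl1 hl4 (WithLp.toLp 2 (klFermiPoint μ 0 θ))
          rw [hμc]
          simpa only [Int.mul_zero, zpow_zero, mul_one, Nat.cast_zero, mul_zero] using h) hkpos hk4
      rw [show (fun θ : ℝ => klLocalPart L M β U μ 0 0 θ) = klLocalPart L M β U μ 0 0 from rfl, hνF]
      refine hcurve.trans (le_of_eq ?_)
      simp only [curveJetBar, hkne, if_false, hμc]
  refine ⟨hjets, ?_⟩
  -- the mean-free clause from the off-site VALUE sum alone (on-site part drops exactly, p600439)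
  have hcont : Continuous fun θ : ℝ => klLocalPart L M β U μ 0 0 θ := by
    have h := hjets.1.continuous; rwa [klFlowFrameU_zero] at h
  refine twoLegReadOscAt_frameZero_of_offSite (L := L) (M := M) hβ0 U μ hcont fun σ p₀ => ?_
  have h := hBoff 0 (Nat.zero_le _) σ p₀
  simpa only [pow_zero] using h

/-! ## §3 The REGISTERED n = 0 conclusion of stub (C) -/

/-- **(C) AT `n = 0`, REGISTERED TABLES, from natural-size inputs + five numeric fits**: `2v ≤ klC4aJetC2 0`, `readJetC (2b) k ≤ klC4aJetC2 k` and
`readJetC′ R (2b) k ≤ klC4aJetC′ P R k` (`1 ≤ k ≤ 4`), `2b₀ ≤ klC4aJetC′ P R 0`, `4b₀ ≤ klReadOscC P R` ⟹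
`TwoLegReadJetBound L M klC4aJetC2 (klC4aJetC′ P R) β U μ (K₀) 0 ∧ TwoLegReadOscAt L M (klReadOscC P R) β U μ (K₀) 0`. -/
theorem twoLegRead_frameZero_registered_of_offSite (P : SplitConsts) (hRW : R.WF) (hc : 0 < c) (hcle : c ≤ klCurveC3 R) (hμ : μ ∈ klWindowC)
    (hU : 0 < U) (hUle : U ≤ klCurveU0 R) (hU1 : U ≤ 1) (hβ : klBetaMin ≤ β) (hβc : β ≤ Real.exp (c / U ^ 2)) {v : ℝ} {b : ℕ → ℝ}
    (hb : ∀ k, 0 ≤ b k)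
    (hBon : ∀ (σ : Fin 2) (p₀ : GridPoint L (2 * (2 * M))), ∑ p₁ : GridPoint L (2 * (2 * M)),
      (if p₁.2 - p₀.2 = 0 then (1 : ℝ) else 0) *
        ‖kernel ℂ
          (effAction ℂ ((hubbardGridSub L M β (2 * (2 * M))).transpose * hubbardCovAboveCT L M β μ 0 0 klE0 *
              hubbardGridSub L M β (2 * (2 * M))) (hubbardGridInteraction L (2 * (2 * M)) β U))
          2 (fun i => ((![p₀, p₁] i, σ), i))‖ ≤ v * |U| * (β / ((2 * (2 * M) : ℕ) : ℝ)))
    (hBoff : ∀ k ≤ 4, ∀ (σ : Fin 2) (p₀ : GridPoint L (2 * (2 * M))), ∑ p₁ : GridPoint L (2 * (2 * M)),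
      (if p₁.2 - p₀.2 = 0 then (0 : ℝ) else
        (1 + (((p₁.2 - p₀.2) 0).valMinAbs.natAbs : ℝ) + (((p₁.2 - p₀.2) 1).valMinAbs.natAbs : ℝ)) ^ k) *
        ‖kernel ℂ
          (effAction ℂ ((hubbardGridSub L M β (2 * (2 * M))).transpose * hubbardCovAboveCT L M β μ 0 0 klE0 *
              hubbardGridSub L M β (2 * (2 * M))) (hubbardGridInteraction L (2 * (2 * M)) β U))
          2 (fun i => ((![p₀, p₁] i, σ), i))‖ ≤ b k * U ^ 2 * (β / ((2 * (2 * M) : ℕ) : ℝ)))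
    -- the five fits against the registered tables
    (hfit0 : 2 * v ≤ klC4aJetC2 0) (hfit : ∀ k, 1 ≤ k → k ≤ 4 → readJetC (fun l => 2 * b l) k ≤ klC4aJetC2 k)
    (hfit0' : 2 * b 0 ≤ klC4aJetC' P R 0) (hfit' : ∀ k, 1 ≤ k → k ≤ 4 → readJetC' R (fun l => 2 * b l) k ≤ klC4aJetC' P R k)
    (hfitO : 4 * b 0 ≤ klReadOscC P R) :
    TwoLegReadJetBound L M klC4aJetC2 (klC4aJetC' P R) β U μ (klFlowFrameU L M β U μ 0) 0 ∧
      TwoLegReadOscAt L M (klReadOscC P R) β U μ (klFlowFrameU L M β U μ 0) 0 := by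
  obtain ⟨hJ, hO⟩ := twoLegRead_frameZero_of_offSite (L := L) (M := M) hRW hc hcle hμ hU hUle hU1 hβ hβc hb hBon hBoff
  refine ⟨hJ.mono (fun k => ?_) (fun k => ?_), hO.mono hfitO⟩
  · rcases Nat.eq_zero_or_pos k with rfl | hkpos
    · simpa only [if_true] using hfit0
    · have hkne : k ≠ 0 := by omega
      rw [if_neg hkne]
      by_cases hk4 : k ≤ 4
      · exact hfit k hkpos hk4
      · have hz : readJetC (fun l => 2 * b l) k = 0 := by
          unfold readJetC; rw [if_neg (by omega), if_neg (by omega), if_neg (by omega), if_neg (by omega)]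
        rw [hz]; exact klC4aJetC2_nonneg k
  · rcases Nat.eq_zero_or_pos k with rfl | hkpos
    · simpa only [if_true] using hfit0'
    · have hkne : k ≠ 0 := by omega
      rw [if_neg hkne]
      by_cases hk4 : k ≤ 4
      · exact hfit' k hkpos hk4
      · have hz : readJetC' R (fun l => 2 * b l) k = 0 := by
          unfold readJetC'; rw [if_neg (by omega), if_neg (by omega)]
        rw [hz]; exact klC4aJetC'_nonneg P R k

/-- **THE SAME UNDER STUB (C)'s LITERAL BINDERS** (`P.WF`, `R.WF2`, `0 < c ≤ klEngC₃6 P R`, `0 < U ≤ klEngU₀9 P R c`, `klBetaMin ≤ β ≤ e^{c/U²}`, `μ ∈ klWindowC`;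
the volume binders and `EngineBoundsAtV17F2 … 0` are not needed): the n = 0 case of `stub_twoLeg_curvature` (v1 and every v2 image) from the natural-size
inputs (on)/(off) and the five fits — what item #22's supplier closes BY NAME. -/
theorem twoLegRead_frameZero_registered_of_offSite_klEng (P : SplitConsts) (R : RenConsts) (c : ℝ) (hR : R.WF2) (hc : 0 < c)
    (hc3 : c ≤ klEngC₃6 P R) (hμ : μ ∈ klWindowC) (hU : 0 < U) (hUle : U ≤ klEngU₀9 P R c) (hβ : klBetaMin ≤ β)
    (hβc : β ≤ Real.exp (c / U ^ 2)) {v : ℝ} {b : ℕ → ℝ} (hb : ∀ k, 0 ≤ b k)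
    (hBon : ∀ (σ : Fin 2) (p₀ : GridPoint L (2 * (2 * M))), ∑ p₁ : GridPoint L (2 * (2 * M)),
      (if p₁.2 - p₀.2 = 0 then (1 : ℝ) else 0) *
        ‖kernel ℂ
          (effAction ℂ ((hubbardGridSub L M β (2 * (2 * M))).transpose * hubbardCovAboveCT L M β μ 0 0 klE0 *
              hubbardGridSub L M β (2 * (2 * M))) (hubbardGridInteraction L (2 * (2 * M)) β U))
          2 (fun i => ((![p₀, p₁] i, σ), i))‖ ≤ v * |U| * (β / ((2 * (2 * M) : ℕ) : ℝ)))
    (hBoff : ∀ k ≤ 4, ∀ (σ : Fin 2) (p₀ : GridPoint L (2 * (2 * M))), ∑ p₁ : GridPoint L (2 * (2 * M)),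
      (if p₁.2 - p₀.2 = 0 then (0 : ℝ) else
        (1 + (((p₁.2 - p₀.2) 0).valMinAbs.natAbs : ℝ) + (((p₁.2 - p₀.2) 1).valMinAbs.natAbs : ℝ)) ^ k) *
        ‖kernel ℂ
          (effAction ℂ ((hubbardGridSub L M β (2 * (2 * M))).transpose * hubbardCovAboveCT L M β μ 0 0 klE0 *
              hubbardGridSub L M β (2 * (2 * M))) (hubbardGridInteraction L (2 * (2 * M)) β U))
          2 (fun i => ((![p₀, p₁] i, σ), i))‖ ≤ b k * U ^ 2 * (β / ((2 * (2 * M) : ℕ) : ℝ)))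
    (hfit0 : 2 * v ≤ klC4aJetC2 0) (hfit : ∀ k, 1 ≤ k → k ≤ 4 → readJetC (fun l => 2 * b l) k ≤ klC4aJetC2 k)
    (hfit0' : 2 * b 0 ≤ klC4aJetC' P R 0) (hfit' : ∀ k, 1 ≤ k → k ≤ 4 → readJetC' R (fun l => 2 * b l) k ≤ klC4aJetC' P R k)
    (hfitO : 4 * b 0 ≤ klReadOscC P R) :
    TwoLegReadJetBound L M klC4aJetC2 (klC4aJetC' P R) β U μ (klFlowFrameU L M β U μ 0) 0 ∧
      TwoLegReadOscAt L M (klReadOscC P R) β U μ (klFlowFrameU L M β U μ 0) 0 := by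
  have hRge : ∀ j, 0 ≤ R.Gfr j := hR.1.2.2
  have hcle : c ≤ klCurveC3 R := (hc3.trans (klEngC₃6_le_klEngC₃3 P R)).trans (klEngC₃3_le_klCurveC3 P hRge)
  have hU3 : U ≤ klEngU₀3 P R c := hUle.trans (klEngU₀9_le_klEngU₀3 P R c)
  have hUle' : U ≤ klCurveU0 R := hU3.trans (klEngU₀3_le_klCurveU0 P hRge c)
  have hU1 : U ≤ 1 := le_one_of_le_klEngU₀3 hU3
  exact twoLegRead_frameZero_registered_of_offSite P hR.1 hc hcle hμ hU hUle' hU1 hβ hβc hb hBon hBoff hfit0 hfit hfit0' hfit' hfitO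

/-! ## §4 The CERTIFIED-CURVE twin (generic Fermi-point sizes `D i`): the route a natural-size supplier can actually fit

The tables of §2–§3 run through k3c3-p3's structured link at the tree's ANALYTIC free-curve majorants `klCurveD1 ≈ 2.3·10²`, `klCurveD2 ≈ 6.8·10⁵`,
`klCurveD3 0 ≈ 6·10⁹`, `klCurveD4 0 0 ≈ 9·10¹³` (tower over `klCurveD = cDtmin(−1.1,−0.1)/2`): the §3 fits then force `b₁ ≤ 2¹¹/(2·klCurveD4 0 0) ≈ 10⁻¹¹` —
no natural supplier meets that.  The natural-size route keys the chain rule on CERTIFIED per-cell sizes of the free Fermi-point map (the (C1)-certificate /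
JACCERT pattern: `D 1 … D 4 = O(1…10²)`), via the generic Bell bound `abs_iteratedDeriv_comp_le_bell`; no regime binder is needed beyond `klBetaMin ≤ β`. -/

/-- **(C) AT `n = 0` FROM NATURAL-SIZE INPUTS, CERTIFIED CURVE SIZES — PRIVATE TABLES.**  With the on-site value sum `≤ v·|U|·β/(4M)`, the off-site moments
`≤ b_k·U²·β/(4M)` (`k ≤ 4`), the free Fermi-point map `γ₀ = toLp ∘ klFermiPoint μ 0 ∈ C⁴` with `‖γ₀^{(i)}(θ)‖ ≤ D i` (`1 ≤ i ≤ 4`, every `θ`):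
`TwoLegReadJetBound L M cB cB′ β U μ (K₀) 0 ∧ TwoLegReadOscAt L M (4·b 0) β U μ (K₀) 0` with the Bell tables
`cB = (2v, 2b₁D₁, 2b₂D₁² + 2b₁D₂, 2b₃D₁³ + 6b₂D₁D₂ + 2b₁D₃, 2b₄D₁⁴ + 12b₃D₁²D₂ + 6b₂D₂² + 8b₂D₁D₃ + 2b₁D₄, 0, …)`, `cB′ = (2b₀, 0, 0, …)`. -/
theorem twoLegRead_frameZero_of_offSite_certD (hβ : klBetaMin ≤ β) {v : ℝ} {b D : ℕ → ℝ}
    (hBon : ∀ (σ : Fin 2) (p₀ : GridPoint L (2 * (2 * M))), ∑ p₁ : GridPoint L (2 * (2 * M)),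
      (if p₁.2 - p₀.2 = 0 then (1 : ℝ) else 0) *
        ‖kernel ℂ
          (effAction ℂ ((hubbardGridSub L M β (2 * (2 * M))).transpose * hubbardCovAboveCT L M β μ 0 0 klE0 *
              hubbardGridSub L M β (2 * (2 * M))) (hubbardGridInteraction L (2 * (2 * M)) β U))
          2 (fun i => ((![p₀, p₁] i, σ), i))‖ ≤ v * |U| * (β / ((2 * (2 * M) : ℕ) : ℝ)))
    (hBoff : ∀ k ≤ 4, ∀ (σ : Fin 2) (p₀ : GridPoint L (2 * (2 * M))), ∑ p₁ : GridPoint L (2 * (2 * M)),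
      (if p₁.2 - p₀.2 = 0 then (0 : ℝ) else
        (1 + (((p₁.2 - p₀.2) 0).valMinAbs.natAbs : ℝ) + (((p₁.2 - p₀.2) 1).valMinAbs.natAbs : ℝ)) ^ k) *
        ‖kernel ℂ
          (effAction ℂ ((hubbardGridSub L M β (2 * (2 * M))).transpose * hubbardCovAboveCT L M β μ 0 0 klE0 *
              hubbardGridSub L M β (2 * (2 * M))) (hubbardGridInteraction L (2 * (2 * M)) β U))
          2 (fun i => ((![p₀, p₁] i, σ), i))‖ ≤ b k * U ^ 2 * (β / ((2 * (2 * M) : ℕ) : ℝ)))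
    (hγ : ContDiff ℝ 4 fun θ : ℝ => (WithLp.toLp 2 (klFermiPoint μ 0 θ) : Momentum))
    (hD : ∀ θ : ℝ, ∀ i, 1 ≤ i → i ≤ 4 → ‖iteratedDeriv i (fun θ : ℝ => (WithLp.toLp 2 (klFermiPoint μ 0 θ) : Momentum)) θ‖ ≤ D i) :
    TwoLegReadJetBound L M
        (fun k => if k = 0 then 2 * v else if k = 1 then 2 * b 1 * D 1 else if k = 2 then 2 * b 2 * D 1 ^ 2 + 2 * b 1 * D 2
          else if k = 3 then 2 * b 3 * D 1 ^ 3 + 3 * (2 * b 2) * D 1 * D 2 + 2 * b 1 * D 3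
          else if k = 4 then 2 * b 4 * D 1 ^ 4 + 6 * (2 * b 3) * D 1 ^ 2 * D 2 + 3 * (2 * b 2) * D 2 ^ 2 + 4 * (2 * b 2) * D 1 * D 3 + 2 * b 1 * D 4
          else 0)
        (fun k => if k = 0 then 2 * b 0 else 0) β U μ (klFlowFrameU L M β U μ 0) 0 ∧
      TwoLegReadOscAt L M (4 * b 0) β U μ (klFlowFrameU L M β U μ 0) 0 := by
  have hβ0 : 0 < β := lt_of_lt_of_le (by norm_num [klBetaMin]) hβ
  obtain ⟨h0, hk⟩ := twoLeg_momentumSizes_frameZero_of_split (L := L) (M := M) hβ U μ hBon hBoff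
  set F : Momentum → ℝ := evalM (symInterp L (klLocSelfEnergyRe L M β U μ 0 0)) with hF
  have hFc : ContDiff ℝ 4 F := contDiff_evalM _
  have hνF : klLocalPart L M β U μ 0 0 = F ∘ fun θ : ℝ => (WithLp.toLp 2 (klFermiPoint μ 0 θ) : Momentum) := by
    have h := klLocalPart_zero_sub_frame_eq_comp (L := L) (M := M) β U μ (0 : TrigPolyC4v)
    have hl : (fun θ => klLocalPart L M β U μ 0 0 θ - (0 : TrigPolyC4v).eval (klFermiPoint μ 0 θ)) = klLocalPart L M β U μ 0 0 := by
      funext θ; simp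
    rw [hl] at h
    rw [h]
    congr 1
    funext p
    simp [hF, evalM_apply]
  have hC : ContDiff ℝ 4 (fun θ : ℝ => klLocalPart L M β U μ 0 0 θ) := by
    rw [show (fun θ : ℝ => klLocalPart L M β U μ 0 0 θ) = klLocalPart L M β U μ 0 0 from rfl, hνF]; exact hFc.comp hγ
  have hjets : TwoLegReadJetBound L M
      (fun k => if k = 0 then 2 * v else if k = 1 then 2 * b 1 * D 1 else if k = 2 then 2 * b 2 * D 1 ^ 2 + 2 * b 1 * D 2
        else if k = 3 then 2 * b 3 * D 1 ^ 3 + 3 * (2 * b 2) * D 1 * D 2 + 2 * b 1 * D 3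
        else if k = 4 then 2 * b 4 * D 1 ^ 4 + 6 * (2 * b 3) * D 1 ^ 2 * D 2 + 3 * (2 * b 2) * D 2 ^ 2 + 4 * (2 * b 2) * D 1 * D 3 + 2 * b 1 * D 4
        else 0)
      (fun k => if k = 0 then 2 * b 0 else 0) β U μ (klFlowFrameU L M β U μ 0) 0 := by
    rw [klFlowFrameU_zero]
    refine ⟨hC, fun k hk4 θ => ?_⟩
    -- the Bell bound at this angle with `M k := 2·b k·U²`
    have hbell := abs_iteratedDeriv_comp_le_bell hFc hγ (θ := θ) (M := fun k => 2 * b k * U ^ 2) (D := D)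
      (fun l hl1 hl4 => hk l hl1 hl4 _) (hD θ)
    rw [show (fun θ : ℝ => klLocalPart L M β U μ 0 0 θ) = klLocalPart L M β U μ 0 0 from rfl, hνF]
    rcases Nat.eq_zero_or_pos k with rfl | hkpos
    · -- order 0: the value `≤ 2v|U| + 2b₀U²`
      rw [iteratedDeriv_zero, Function.comp_apply, ← Real.norm_eq_abs, ← norm_iteratedFDeriv_zero (𝕜 := ℝ)]
      refine (h0 _).trans (le_of_eq ?_)
      simp only [if_true, curveJetBar, uPow, Nat.cast_zero, zero_sub, mul_zero, zpow_zero, mul_one]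
      rw [show U ^ 2 = |U| * |U| by rw [← sq, sq_abs]]; ring
    · have hkne : k ≠ 0 := by omega
      obtain ⟨h1, h2, h3, h4⟩ := hbell
      interval_cases k
      · refine h1.trans (le_of_eq ?_); simp [curveJetBar, uPow]; ring
      · refine h2.trans (le_of_eq ?_); simp [curveJetBar, uPow]; ring
      · refine h3.trans (le_of_eq ?_); simp [curveJetBar, uPow]; ring
      · refine h4.trans (le_of_eq ?_); simp [curveJetBar, uPow]; ring
  refine ⟨hjets, ?_⟩
  have hcont : Continuous fun θ : ℝ => klLocalPart L M β U μ 0 0 θ := hC.continuous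
  refine twoLegReadOscAt_frameZero_of_offSite (L := L) (M := M) hβ0 U μ hcont fun σ p₀ => ?_
  have h := hBoff 0 (Nat.zero_le _) σ p₀
  simpa only [pow_zero] using h

end Summit.HubbardSuperconductivity.HubbardSuperconductivity.Theorems.KLRegimeSplit

end
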